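import Summits.ResolutionOfSingularities.KangarooAtlas.MizutaniFieldAutHironaka
import HarnessLib

/-!
# Field automorphisms of `k` on ODA's side: `(L_B)_e`, the exponent and `dim B` are `Aut(k)`-invariant

Cell `pub-rosobs`, Mizutani enclosure (seat mizutani-encloser-2, gen 9). AI-written; *AI review is weaker than expert
review*; NOT a resolution-of-singularities theorem (summit relevance C).

Sequel to `MizutaniFieldAutHironaka.lean` (the `σ ∈ Aut(k)` part of Mizutani's «same type», p. 87, on Hironaka's objects).  Here
the invariant additive forms and the numerical invariants, for `τ_σ = MvPolynomial.map σ` and the conjugate point `𝔭.comap τ_σ`: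

* `map_addForm` — `τ_σ (Σ a_j X_j^{p^e}) = Σ σ(a_j) X_j^{p^e}`; **`mem_hirForms_comap_map_iff`**, **`mem_invForms_comap_map_iff`** —
  `a ∈ (L_B)_e(τ^{-1}𝔭) ↔ σ ∘ a ∈ (L_B)_e(𝔭)` (through the multiplicity reading `hirForms_eq_invForms`: no differential operator is
  conjugated); `frobVec_comp_ringEquiv`, `comp_mem_span_image_comp` (a `σ`-semilinear bijection maps `k`-spans onto `k`-spans);
* **`exponentLE_comap_map_iff`**, **`exponent_comap_map`** — the exponent of `B(𝔭)` is `Aut(k)`-invariant;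
  **`hsDim_comap_map`** — so is `dim B(𝔭)` (through `ringKrullDim (S ⧸ U_+S)`, `ringKrullDim_quotient_bIdeal_comap_map`).

With `MizutaniCoordChange`/`MizutaniCoordChangeHironaka` (the `ψ` part) every object of the dictionary is invariant under Mizutani's full
«type» group `Aut(k) ⋉ GL_{n+1}`; «of the same type as Example 2.1» (`extremal_iff_type`, `mizutani1973_theorem28`) is therefore a
statement about types in his sense.

## References

* H. Mizutani, *Hironaka's additive group schemes*, Nagoya Math. J. 52 (1973) 85–95, p. 87 («type»), §1 (c), Thm. 1.3. [Mizutani1973HironakaGroupSchemes]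
* T. Oda, *Hironaka's additive group scheme, II*, Publ. RIMS 19 (1983), §2 (p. 1168). [Oda1983HironakaGroupSchemeII]
-/

noncomputable section

open MvPolynomial Literature.AlgebraicGeometry.Resolution Literature.AlgebraicGeometry.Resolution.HironakaScheme
  Literature.RingTheory.MvPolynomial

namespace Summit.ResolutionOfSingularities.KangarooAtlas.Mizutani

universe u

section FieldAut

variable (k : Type u) [Field k] (p : ℕ) [hp : Fact p.Prime] [CharP k p] {n : ℕ} (σ : k ≃+* k)

omit hp [CharP k p] in
/-- `τ_σ (Σ a_j X_j^{p^e}) = Σ σ(a_j) X_j^{p^e}`. [folklore] -/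
theorem map_addForm (e : ℕ) (a : Fin (n + 1) → k) :
    MvPolynomial.map (σ : k →+* k) (addForm k p e a) = addForm k p e (fun j => σ (a j)) := by
  unfold addForm
  rw [map_sum]
  refine Finset.sum_congr rfl fun j _ => ?_
  rw [map_mul, map_C, map_pow, map_X]
  rfl

omit hp [CharP k p] in
/-- `F^m` commutes with `σ` on coefficient vectors. [folklore] -/
theorem frobVec_comp_ringEquiv (m : ℕ) (a : Fin (n + 1) → k) :
    frobVec k p m (fun j => σ (a j)) = fun j => σ (frobVec k p m a j) := by
  funext j
  unfold frobVec
  rw [map_pow]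

omit hp [CharP k p] in
/-- A `σ`-semilinear bijection maps `k`-spans into `k`-spans: `v ∈ span Y ⇒ σ ∘ v ∈ span (σ ∘ Y)`. [folklore] -/
theorem comp_mem_span_image_comp (ρ : k ≃+* k) {Y : Set (Fin (n + 1) → k)} {v : Fin (n + 1) → k}
    (hv : v ∈ Submodule.span k Y) :
    (fun j => ρ (v j)) ∈ Submodule.span k ((fun w : Fin (n + 1) → k => fun j => ρ (w j)) '' Y) := by
  induction hv using Submodule.span_induction with
  | mem x hx => exact Submodule.subset_span ⟨x, hx, rfl⟩
  | zero =>
    have h : (fun j => ρ ((0 : Fin (n + 1) → k) j)) = 0 := by funext j; simp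
    rw [h]; exact Submodule.zero_mem _
  | add x y _ _ hx hy =>
    have h : (fun j => ρ ((x + y) j)) = (fun j => ρ (x j)) + fun j => ρ (y j) := by
      funext j; simp [map_add]
    rw [h]; exact Submodule.add_mem _ hx hy
  | smul c x _ hx =>
    have h : (fun j => ρ ((c • x) j)) = ρ c • fun j => ρ (x j) := by
      funext j; simp [map_mul]
    rw [h]; exact Submodule.smul_mem _ _ hx

omit hp [CharP k p] in
/-- … and onto: `σ ∘ v ∈ span (σ ∘ Y) ↔ v ∈ span Y`. [folklore] -/
theorem comp_mem_span_image_comp_iff {Y : Set (Fin (n + 1) → k)} {v : Fin (n + 1) → k} :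
    (fun j => σ (v j)) ∈ Submodule.span k ((fun w : Fin (n + 1) → k => fun j => σ (w j)) '' Y) ↔
      v ∈ Submodule.span k Y := by
  refine ⟨fun h => ?_, comp_mem_span_image_comp k σ⟩
  have h2 := comp_mem_span_image_comp k σ.symm h
  have hv : (fun j => σ.symm ((fun j => σ (v j)) j)) = v := by funext j; simp
  have hY : (fun w : Fin (n + 1) → k => fun j => σ.symm (w j)) ''
      ((fun w : Fin (n + 1) → k => fun j => σ (w j)) '' Y) = Y := by
    rw [Set.image_image]
    have hid : (fun w : Fin (n + 1) → k => (fun j => σ.symm ((fun j => σ (w j)) j))) = id := by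
      funext w; funext j; simp
    rw [hid, Set.image_id]
  rwa [hv, hY] at h2

variable (𝔭 : Ideal (MvPolynomial (Fin (n + 1)) k))

omit hp [CharP k p] in
/-- **`(U ∩ L)_e` is `Aut(k)`-equivariant**: `a ∈ (U(τ^{-1}𝔭) ∩ L)_e ↔ σ ∘ a ∈ (U(𝔭) ∩ L)_e` (multiplicity of
`Σ a_j X_j^{p^e}` at `τ^{-1}𝔭` = multiplicity of `Σ σ(a_j) X_j^{p^e}` at `𝔭`). [cite: Mizutani1973HironakaGroupSchemes, §1 (c)] -/
theorem mem_hirForms_comap_map_iff [𝔭.IsPrime] (e : ℕ) (a : Fin (n + 1) → k) :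
    a ∈ hirForms k p (𝔭.comap (MvPolynomial.map (σ : k →+* k))) e ↔ (fun j => σ (a j)) ∈ hirForms k p 𝔭 e := by
  rw [mem_hirForms_iff, mem_hirForms_iff]
  have h := mem_symbPow_comap_map_iff k σ 𝔭 (p ^ e) (addForm k p e a)
  unfold symbPow at h
  simp only [Set.mem_setOf_eq] at h
  rw [map_addForm] at h
  exact h

/-- **Oda's `(L_B)_e` is `Aut(k)`-equivariant**: `a ∈ (L_B)_e(τ^{-1}𝔭) ↔ σ ∘ a ∈ (L_B)_e(𝔭)` (for primes, via `hirForms_eq_invForms`).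
[cite: Oda1983HironakaGroupSchemeII, §2 (p. 1168)] -/
theorem mem_invForms_comap_map_iff [𝔭.IsPrime] (e : ℕ) (a : Fin (n + 1) → k) :
    a ∈ invForms k p (𝔭.comap (MvPolynomial.map (σ : k →+* k))) e ↔ (fun j => σ (a j)) ∈ invForms k p 𝔭 e := by
  rw [← hirForms_eq_invForms, ← hirForms_eq_invForms 𝔭 e]
  exact mem_hirForms_comap_map_iff k p σ 𝔭 e a

/-- The image of `(L_B)_e(τ^{-1}𝔭)` under `a ↦ σ ∘ a` is `(L_B)_e(𝔭)`. [cite: Oda1983HironakaGroupSchemeII, §2 (p. 1168)] -/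
theorem image_comp_invForms_comap_map [𝔭.IsPrime] (e : ℕ) :
    (fun w : Fin (n + 1) → k => fun j => σ (w j)) ''
        (invForms k p (𝔭.comap (MvPolynomial.map (σ : k →+* k))) e : Set (Fin (n + 1) → k)) =
      (invForms k p 𝔭 e : Set (Fin (n + 1) → k)) := by
  ext b
  constructor
  · rintro ⟨a, ha, rfl⟩
    exact (mem_invForms_comap_map_iff k p σ 𝔭 e a).mp ha
  · intro hb
    refine ⟨fun j => σ.symm (b j), (mem_invForms_comap_map_iff k p σ 𝔭 e _).mpr ?_, ?_⟩
    · have h : (fun j => σ ((fun j => σ.symm (b j)) j)) = b := by funext j; simp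
      rw [h]; exact hb
    · funext j; simp

/-- **THE EXPONENT CONDITION IS `Aut(k)`-INVARIANT**: `exponent B(τ^{-1}𝔭) ≤ e ↔ exponent B(𝔭) ≤ e`.
[cite: Mizutani1973HironakaGroupSchemes, §1 (c); Oda1983HironakaGroupSchemeII, §2 (p. 1168)] -/
theorem exponentLE_comap_map_iff [𝔭.IsPrime] (e : ℕ) :
    ExponentLE k p (𝔭.comap (MvPolynomial.map (σ : k →+* k))) e ↔ ExponentLE k p 𝔭 e := by
  -- both sides say: for `j ≥ e`, membership in `(L_B)_j` ⟺ membership in `span F^{j−e}(L_B)_e`, tested on `σ ∘ a`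
  have key : ∀ j a, (a ∈ Submodule.span k (frobVec k p (j - e) ''
      (invForms k p (𝔭.comap (MvPolynomial.map (σ : k →+* k))) e : Set (Fin (n + 1) → k))) ↔
        (fun i => σ (a i)) ∈ Submodule.span k (frobVec k p (j - e) '' (invForms k p 𝔭 e : Set (Fin (n + 1) → k)))) := by
    intro j a
    rw [← comp_mem_span_image_comp_iff k σ, Set.image_image, ← image_comp_invForms_comap_map k p σ 𝔭 e, Set.image_image]
    have h : (fun w : Fin (n + 1) → k => fun i => σ (frobVec k p (j - e) w i)) =
        fun w => frobVec k p (j - e) fun i => σ (w i) :=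
      funext fun w => (frobVec_comp_ringEquiv k p σ (j - e) w).symm
    rw [h]
  constructor
  · intro hE j hj
    ext b
    have h1 := congrArg (fun N : Submodule k (Fin (n + 1) → k) => (fun i => σ.symm (b i)) ∈ N) (hE j hj)
    simp only [eq_iff_iff] at h1
    rw [mem_invForms_comap_map_iff, key] at h1
    have hb : (fun i => σ ((fun i => σ.symm (b i)) i)) = b := by funext i; simp
    rwa [hb] at h1
  · intro hE j hj
    ext a
    rw [mem_invForms_comap_map_iff, key, hE j hj]

/-- **THE EXPONENT IS `Aut(k)`-INVARIANT**: `exponent B(τ^{-1}𝔭) = exponent B(𝔭)`. [cite: Mizutani1973HironakaGroupSchemes, §1 (c)] -/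
theorem exponent_comap_map [𝔭.IsPrime] :
    exponent k p (𝔭.comap (MvPolynomial.map (σ : k →+* k))) = exponent k p 𝔭 := by
  unfold exponent
  congr 1
  ext e
  exact exponentLE_comap_map_iff k p σ 𝔭 e

/-- **`dim B(𝔭)` IS `Aut(k)`-INVARIANT**: `hsDim (τ^{-1}𝔭) = hsDim 𝔭` for every point (through `ringKrullDim (S ⧸ U_+S)`).
[cite: Mizutani1973HironakaGroupSchemes, Thm. 1.3] -/
theorem hsDim_comap_map [𝔭.IsPrime] (hP : IsPoint k 𝔭) :
    hsDim k p (𝔭.comap (MvPolynomial.map (σ : k →+* k))) = hsDim k p 𝔭 := by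
  have hP' := isPoint_comap_map k σ hP
  have h1 := ringKrullDim_quotient_bIdeal_eq_hsDim_holds k p _ hP'
  have h2 := ringKrullDim_quotient_bIdeal_eq_hsDim_holds k p 𝔭 hP
  rw [ringKrullDim_quotient_bIdeal_comap_map k σ 𝔭, h2] at h1
  exact_mod_cast h1.symm

end FieldAut

end Summit.ResolutionOfSingularities.KangarooAtlas.Mizutani

end
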